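import Literature.MathematicalPhysics.QuantumFieldTheory.Federbush1986.PhaseCellIVExcitationCoupling

/-!
# Federbush, *A phase cell approach to Yang–Mills theory. IV. The choice of variables* (CMP **114** (1988) 317–343) —
# §5 p. 328, the lattice partition of unity (5.3): EXISTENCE of `φ ∈ C^∞` with `φ_α(x) = φ(x − α)`, `φ(0) = 1`, `φ(x) = 0` for
# `|x| > 2`, `Σ_{α∈Z^d} φ_α(x) = 1` — PROVED by an explicit product of one-dimensional telescoping bumps

statement-level skeleton of published theorems with citation tags; proofs where landed; nothing here is a claim about the Yang–Mills mass gap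

Cell `lit-balaban`, reader/typer block **r19** (F4 fold owner), inventory row `F4.Def§4` (§§4–7) of
`run/shared/lean/pub/lit-balaban/lit-balaban-r19/ROWS-F4.md`; discharges the structure `PhaseCellIVCoupling.IsLatticePOU` typed in
`PhaseCellIVExcitationCoupling` (p315105).

**Source.** P. Federbush, Commun. Math. Phys. **114** (1988) 317–343 [bib `Federbush1988PhaseCellIV`; doi:10.1007/bf01225039;
lit store `paper:doi-10-1007-bf01225039`; journal page = PDF page + 316], p. 328 [PDF 12] READ AS AN IMAGE (render
`lit-balaban-r19/renders/f4/f4-p012.png`).  Verbatim: «For each level, `r`, we will need a partition of unity with functions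
labelled by vertices in `𝒱^r`.  We first discuss a partition of unity on `R⁴` with functions labelled by points `α ∈ Z⁴`.
`1 = Σ_{α∈Z} φ_α(x)`, `x ∈ R⁴`. (5.3)  The `φ_α` are `C^∞` with the properties 1) `{φ_α(x)}` is translation invariant.  That
is, `φ_α(x) = φ(x − α)` for some function `φ(x)`.  2) `φ(x)` is invariant under the discrete symmetries of the lattice `Z⁴`
(with origin fixed).  (This requirement is not necessary.)  3) `φ(0) = 1`,  4) `φ(x) = 0` if `|x| > 2`.»  Print asserts the
existence of such a `φ` without construction.

**The construction (ours; standard).**  Let `F(t) = S(4t + ½)` with `S` Mathlib's `Real.smoothTransition` (`C^∞`, `= 0` on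
`t ≤ 0`, `= 1` on `t ≥ 1`), so `F = 0` for `t ≤ −⅛` and `F = 1` for `t ≥ ⅛`; put `χ(t) = F(t + ½) − F(t − ½)`.  Then `χ ∈ C^∞`,
`χ(0) = 1`, `χ(t) = 0` for `|t| ≥ ⅝`, and `Σ_{n∈Z} χ(t − n) = 1` (the sum telescopes: the three terms `n = ⌊t⌋ − 1, ⌊t⌋, ⌊t⌋ + 1`
are the only non-zero ones and add up to `F(t − ⌊t⌋ + 3⁄2) − F(t − ⌊t⌋ − 3⁄2) = 1 − 0`).  Finally `φ(x) = Π_i χ(x_i)` on `R^d`: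
`φ ∈ C^∞`, `φ(0) = 1`, `φ(x) = 0` as soon as some `|x_i| ≥ ⅝`, and `Σ_{α∈Z^d} φ(x − α) = Π_i Σ_{n} χ(x_i − n) = 1` (a finite sum,
`3^d` non-zero terms).  Property 4) with the EUCLIDEAN `|x| > 2`: if all `|x_i| < ⅝` then `|x|² < 25d⁄64`, which is `< 4` iff
`d ≤ 10`; so 4) holds for `d ≤ 10` (print: `d = 4`).  (For `d > 16` no `φ` at all can have 4) and (5.3) at once: the centre
`(½, …, ½)` of the unit cell is at Euclidean distance `≥ √d⁄2 > 2` from every lattice point, so 4) kills every term of (5.3)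
there.  The bound `d ≤ 10` is a feature of this particular construction and covers print's case; nothing is claimed here for
`d > 10`.)

**What this file does.** `F`, `chi`, `pou` with the properties above PROVED (`chi_zero`, `chi_eq_zero`, `sum_chi_three`,
`hasSum_chi`, `contDiff_pou`, `pou_zero`, `pou_eq_zero_of_coord`, `pou_eq_zero_of_norm` (`d ≤ 10`), `hasSum_pou`), and
**`isLatticePOU_pou : IsLatticePOU (pou d)` for every `d ≤ 10`**, in particular `exists_isLatticePOU_four` for print's `R⁴`.
No `sorry`, no new `Prop`-facts.
-/

namespace Literature.MathematicalPhysics.QuantumFieldTheory.Federbush1986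

noncomputable section

open Set Finset

namespace PhaseCellIVCoupling

namespace POU

/-! ## 1. The one-dimensional bump `χ` -/

/-- The smooth step `F(t) = S(4t + ½)`: `0` for `t ≤ −⅛`, `1` for `t ≥ ⅛`. [cite: Federbush1988PhaseCellIV, (5.3) p. 328] -/
def F (t : ℝ) : ℝ := Real.smoothTransition (4 * t + 1 / 2)

/-- `F = 1` on `[⅛, ∞)`. [cite: Federbush1988PhaseCellIV, (5.3) p. 328] -/
theorem F_eq_one {t : ℝ} (ht : 1 / 8 ≤ t) : F t = 1 :=
  Real.smoothTransition.one_of_one_le (by linarith)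

/-- `F = 0` on `(−∞, −⅛]`. [cite: Federbush1988PhaseCellIV, (5.3) p. 328] -/
theorem F_eq_zero {t : ℝ} (ht : t ≤ -(1 / 8)) : F t = 0 :=
  Real.smoothTransition.zero_of_nonpos (by linarith)

/-- `F` is smooth. [cite: Federbush1988PhaseCellIV, (5.3) p. 328] -/
theorem contDiff_F : ContDiff ℝ (⊤ : ℕ∞) F :=
  Real.smoothTransition.contDiff.comp ((contDiff_const.mul contDiff_id).add contDiff_const)

/-- The bump `χ(t) = F(t + ½) − F(t − ½)`. [cite: Federbush1988PhaseCellIV, (5.3) p. 328] -/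
def chi (t : ℝ) : ℝ := F (t + 1 / 2) - F (t - 1 / 2)

/-- 3) in one dimension: `χ(0) = 1`. [cite: Federbush1988PhaseCellIV, (5.3) 3) p. 328] -/
theorem chi_zero : chi 0 = 1 := by
  rw [chi, F_eq_one (by norm_num), F_eq_zero (by norm_num)]; norm_num

/-- 4) in one dimension: `χ(t) = 0` for `|t| ≥ ⅝`. [cite: Federbush1988PhaseCellIV, (5.3) 4) p. 328] -/
theorem chi_eq_zero {t : ℝ} (ht : 5 / 8 ≤ |t|) : chi t = 0 := by
  rcases le_abs'.mp ht with h | h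
  · rw [chi, F_eq_zero (by linarith), F_eq_zero (by linarith)]; norm_num
  · rw [chi, F_eq_one (by linarith), F_eq_one (by linarith)]; norm_num

/-- `χ` is smooth. [cite: Federbush1988PhaseCellIV, (5.3) p. 328] -/
theorem contDiff_chi : ContDiff ℝ (⊤ : ℕ∞) chi :=
  (contDiff_F.comp (contDiff_id.add contDiff_const)).sub (contDiff_F.comp (contDiff_id.sub contDiff_const))

/-- The three lattice translates around `t` that can be non-zero: `n ∈ {⌊t⌋ − 1, ⌊t⌋, ⌊t⌋ + 1}`.
[cite: Federbush1988PhaseCellIV, (5.3) p. 328] -/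
def window (t : ℝ) : Finset ℤ := {⌊t⌋ - 1, ⌊t⌋, ⌊t⌋ + 1}

/-- Outside the window the translate vanishes: `χ(t − n) = 0`. [cite: Federbush1988PhaseCellIV, (5.3) p. 328] -/
theorem chi_sub_eq_zero {t : ℝ} {n : ℤ} (hn : n ∉ window t) : chi (t - n) = 0 := by
  have h1 := Int.floor_le t
  have h2 := Int.lt_floor_add_one t
  simp only [window, Finset.mem_insert, Finset.mem_singleton, not_or] at hn
  obtain ⟨hn1, hn2, hn3⟩ := hn
  apply chi_eq_zero
  rcases lt_or_gt_of_ne hn2 with h | h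
  · have : n ≤ ⌊t⌋ - 2 := by omega
    have : (n : ℝ) ≤ ⌊t⌋ - 2 := by exact_mod_cast this
    rw [abs_of_nonneg (by linarith)]; linarith
  · have : ⌊t⌋ + 2 ≤ n := by omega
    have : (⌊t⌋ : ℝ) + 2 ≤ n := by exact_mod_cast this
    rw [abs_of_nonpos (by linarith)]; linarith

/-- The three window terms telescope to `F(t − ⌊t⌋ + 3⁄2) − F(t − ⌊t⌋ − 3⁄2) = 1`. [cite: Federbush1988PhaseCellIV, (5.3) p. 328] -/
theorem sum_chi_three (t : ℝ) : ∑ n ∈ window t, chi (t - n) = 1 := by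
  have h1 := Int.floor_le t
  have h2 := Int.lt_floor_add_one t
  rw [window, Finset.sum_insert (by simp only [Finset.mem_insert, Finset.mem_singleton]; omega),
    Finset.sum_insert (by simp only [Finset.mem_singleton]; omega), Finset.sum_singleton]
  simp only [chi, Int.cast_sub, Int.cast_one, Int.cast_add]
  rw [F_eq_one (t := t - (⌊t⌋ - 1) + 1 / 2) (by linarith), F_eq_zero (t := t - (⌊t⌋ + 1) - 1 / 2) (by linarith)]
  ring

/-- **(5.3) in one dimension**: `Σ_{n∈Z} χ(t − n) = 1`. [cite: Federbush1988PhaseCellIV, (5.3) p. 328] -/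
theorem hasSum_chi (t : ℝ) : HasSum (fun n : ℤ => chi (t - n)) 1 := by
  rw [← sum_chi_three t]
  exact hasSum_sum_of_ne_finset_zero fun n hn => chi_sub_eq_zero hn

/-! ## 2. The `d`-dimensional `φ(x) = Π_i χ(x_i)` -/

/-- **The generating function of (5.3)**: `φ(x) = Π_i χ(x_i)` on `R^d`. [cite: Federbush1988PhaseCellIV, (5.3) p. 328] -/
def pou (d : ℕ) (x : EuclideanSpace ℝ (Fin d)) : ℝ := ∏ i, chi (x i)

/-- «The `φ_α` are `C^∞`»: `φ` is smooth. [cite: Federbush1988PhaseCellIV, (5.3) p. 328] -/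
theorem contDiff_pou (d : ℕ) : ContDiff ℝ (⊤ : ℕ∞) (pou d) := by
  unfold pou
  refine contDiff_prod fun i _ => contDiff_chi.comp ?_
  exact (EuclideanSpace.proj (𝕜 := ℝ) (ι := Fin d) i).contDiff

/-- 3) «`φ(0) = 1`». [cite: Federbush1988PhaseCellIV, (5.3) 3) p. 328] -/
theorem pou_zero (d : ℕ) : pou d 0 = 1 := by
  simp [pou, chi_zero]

/-- 4), box form: `φ(x) = 0` as soon as some coordinate has `|x_i| ≥ ⅝`. [cite: Federbush1988PhaseCellIV, (5.3) 4) p. 328] -/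
theorem pou_eq_zero_of_coord {d : ℕ} {x : EuclideanSpace ℝ (Fin d)} {i : Fin d} (hi : 5 / 8 ≤ |x i|) : pou d x = 0 :=
  Finset.prod_eq_zero (Finset.mem_univ i) (chi_eq_zero hi)

/-- 4) «`φ(x) = 0` if `|x| > 2`» with the Euclidean norm, in every dimension `d ≤ 10` (print: `d = 4`): `|x| > 2` forces a
coordinate `|x_i| ≥ ⅝` since otherwise `|x|² < 25d⁄64 ≤ 4`. [cite: Federbush1988PhaseCellIV, (5.3) 4) p. 328] -/
theorem pou_eq_zero_of_norm {d : ℕ} (hd : d ≤ 10) {x : EuclideanSpace ℝ (Fin d)} (hx : 2 < ‖x‖) : pou d x = 0 := by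
  by_contra hne
  have hcoord : ∀ i, |x i| < 5 / 8 := fun i => by
    by_contra hi
    exact hne (pou_eq_zero_of_coord (not_lt.mp hi))
  have hsq : ‖x‖ ^ 2 = ∑ i, |x i| ^ 2 := by
    rw [EuclideanSpace.norm_eq, Real.sq_sqrt (Finset.sum_nonneg fun i _ => by positivity)]
    simp [sq_abs]
  have hle : ∑ i : Fin d, |x i| ^ 2 ≤ ∑ _i : Fin d, (5 / 8 : ℝ) ^ 2 :=
    Finset.sum_le_sum fun i _ => by
      have := hcoord i
      have h0 := abs_nonneg (x i)
      nlinarith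
  rw [Finset.sum_const, Finset.card_univ, Fintype.card_fin, nsmul_eq_mul] at hle
  have hd' : (d : ℝ) ≤ 10 := by exact_mod_cast hd
  nlinarith [norm_nonneg x]

/-- The translate `φ(x − α) = Π_i χ(x_i − α_i)`. [cite: Federbush1988PhaseCellIV, (5.3) 1) p. 328] -/
theorem pou_sub_latPoint {d : ℕ} (x : EuclideanSpace ℝ (Fin d)) (α : Fin d → ℤ) :
    pou d (x - latPoint α) = ∏ i, chi (x i - α i) := by
  simp [pou, latPoint]

/-- **(5.3)**: `Σ_{α ∈ Z^d} φ(x − α) = 1` for every `x ∈ R^d` (only the `3^d` translates in the product window are non-zero, and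
the finite sum factorises into the one-dimensional sums). [cite: Federbush1988PhaseCellIV, (5.3) p. 328] -/
theorem hasSum_pou (d : ℕ) (x : EuclideanSpace ℝ (Fin d)) : HasSum (fun α : Fin d → ℤ => pou d (x - latPoint α)) 1 := by
  simp only [pou_sub_latPoint]
  have hfin : ∑ α ∈ Fintype.piFinset (fun i => window (x i)), ∏ i, chi (x i - α i) = 1 := by
    rw [← Finset.prod_univ_sum (fun i => window (x i)) (fun i n => chi (x i - n))]
    simp [sum_chi_three]
  rw [← hfin]
  refine hasSum_sum_of_ne_finset_zero fun α hα => ?_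
  rw [Fintype.mem_piFinset] at hα
  push Not at hα
  obtain ⟨i, hi⟩ := hα
  exact Finset.prod_eq_zero (Finset.mem_univ i) (chi_sub_eq_zero hi)

end POU

/-! ## 3. (5.3) is inhabited -/

/-- **Existence of the partition of unity (5.3)** with 1), 3), 4): `POU.pou d` satisfies `IsLatticePOU` in every dimension
`d ≤ 10`. [cite: Federbush1988PhaseCellIV, (5.3) p. 328] -/
theorem isLatticePOU_pou {d : ℕ} (hd : d ≤ 10) : IsLatticePOU (POU.pou d) where
  smooth := POU.contDiff_pou d
  at_zero := POU.pou_zero d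
  eq_zero := fun _ hx => POU.pou_eq_zero_of_norm hd hx
  sum_eq_one := POU.hasSum_pou d

/-- In particular on print's `R⁴`: «a partition of unity on `R⁴` with functions labelled by points `α ∈ Z⁴`» with 1), 3), 4)
EXISTS. [cite: Federbush1988PhaseCellIV, (5.3) p. 328] -/
theorem exists_isLatticePOU_four : ∃ φ : EuclideanSpace ℝ (Fin 4) → ℝ, IsLatticePOU φ :=
  ⟨POU.pou 4, isLatticePOU_pou (by norm_num)⟩

/-- Hence the scaled partitions of unity «for each `r`, with elements associated to the vertices in `𝒱^r`» exist as well (every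
`N`, `r`, `d ≤ 10`). [cite: Federbush1988PhaseCellIV, §5 p. 328] -/
theorem exists_scaledPOU {d : ℕ} (hd : d ≤ 10) (N r : ℕ) :
    ∃ φ : EuclideanSpace ℝ (Fin d) → ℝ, IsLatticePOU φ ∧
      ∀ x, HasSum (fun n : Fin d → ℤ => scaledPOU φ N r n x) 1 :=
  ⟨POU.pou d, isLatticePOU_pou hd, fun x => hasSum_scaledPOU (isLatticePOU_pou hd) N r x⟩

end PhaseCellIVCoupling

end

end Literature.MathematicalPhysics.QuantumFieldTheory.Federbush1986
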